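import Mathlib
import Summits.Ventures.PercRepro.TriangleCapTriangleFreeThreeD

/-!
# PercRepro — THE CLOSED FORM ON THE TRIANGLE-FREE CLASS, `r ≤ 3`, AS ONE STATEMENT (p3, gen 36; part 45)

`sub_diagonal_cliqueFree_exact`: for every `r ≤ 3`, `1 ≤ a`, `a + r ≤ k`, `k ≥ 2`, and `m = a(k − a) − r ≥ 2k − 3` with none of
`m, m + 1, …, m + r − 1` of the form `a′(k − a′)` (so that `r` is the distance from `m` to the least diagonal value above
it), the maximum of `2·Σ_v C(d(v), 2)` over the triangle-free graphs on `Fin k` with `m` edges IS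
`m (k − 2) − r (k − r − 1)`, attained by `K_{a, k−a}` minus `r` edges at one vertex — the closed form
P3-TRIANGLE-CAP.md §10av (`cherries = (m(k−2) − r(k−r−1))/2`) on the triangle-free class for `r = 0, 1, 2, 3`:
`r = 0` is Mantel's degree-sum lemma (TriangleCapCherryMantel), `r = 1` TriangleCapOneBelowDiagonal (§10au),
`r = 2` TriangleCapTriangleFreeTwoB, `r = 3` TriangleCapTriangleFreeThreeD.
Axioms: standard.
-/

namespace PercRepro

namespace TriangleCap

namespace C047

open Finset

/-- **THE CLOSED FORM ON THE TRIANGLE-FREE CLASS FOR `r ≤ 3`.** -/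
theorem sub_diagonal_cliqueFree_exact (k a r : ℕ) (hr : r ≤ 3) (ha : 1 ≤ a) (hak : a + r ≤ k) (hk : 2 ≤ k)
    (hdense : 2 * k ≤ a * (k - a) - r + 3)
    (hm : ∀ a', a' ≤ k → ∀ j, j < r → a * (k - a) - r + j ≠ a' * (k - a')) :
    (∀ (D : SimpleGraph (Fin k)) [DecidableRel D.Adj], D.CliqueFree 3 →
        D.edgeFinset.card = a * (k - a) - r →
        2 * cherries D + r * (k - r - 1) ≤ (a * (k - a) - r) * (k - 2)) ∧
      ∃ (D : SimpleGraph (Fin k)) (_ : DecidableRel D.Adj), D.CliqueFree 3 ∧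
        D.edgeFinset.card = a * (k - a) - r ∧
        2 * cherries D + r * (k - r - 1) = (a * (k - a) - r) * (k - 2) := by
  interval_cases r
  · -- `r = 0`: Mantel
    simp only [Nat.sub_zero, Nat.zero_mul, Nat.add_zero]
    constructor
    · intro D _ hfree hD
      have h := mantel_cherries D hfree
      rw [Fintype.card_fin, hD] at h
      obtain ⟨k', hk'⟩ : ∃ k', k = k' + 2 := ⟨k - 2, by omega⟩
      subst hk'
      have e : k' + 2 - 2 = k' := by omega
      rw [e]
      nlinarith
    · refine ⟨bipMinusStar k a 0, inferInstance,
        cliqueFree_of_bipartite _ (univ.filter (fun i : Fin k => i.val < a)) (bipMinusStar_bipartite k a 0), ?_, ?_⟩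
      · have := card_edges_bipMinusStar k a 0 ha (by omega)
        omega
      · have h := two_mul_cherries_bipMinusStar k a 0 ha (by omega) hk
        omega
  · -- `r = 1`: TriangleCapOneBelowDiagonal
    have h := one_below_diagonal_cliqueFree_exact k a ha (by omega) (fun a' ha' => hm a' ha' 0 (by omega))
    obtain ⟨h1, D, inst, hfree, -, hD, hval⟩ := h
    have hka : 2 ≤ a * (k - a) := by
      have := hm 0 (by omega) 0 (by omega)
      simp only [Nat.zero_mul] at this
      omega
    obtain ⟨m, hmm⟩ : ∃ m, a * (k - a) = m + 2 := ⟨a * (k - a) - 2, by omega⟩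
    have e1 : a * (k - a) - 1 = m + 1 := by omega
    have e2 : a * (k - a) - 2 = m := by omega
    rw [e1, e2] at h1
    rw [e1] at hD
    rw [e2] at hval
    rw [e1]
    have e3 : 1 * (k - 1 - 1) = k - 2 := by omega
    rw [e3]
    obtain ⟨k', hk'⟩ : ∃ k', k = k' + 2 := ⟨k - 2, by omega⟩
    subst hk'
    have e4 : k' + 2 - 2 = k' := by omega
    rw [e4] at h1 hval ⊢
    constructor
    · intro D' _ hfree' hD'
      have := h1 D' hfree' hD'
      nlinarith
    · exact ⟨D, inst, hfree, hD, by nlinarith⟩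
  · -- `r = 2`
    have h := two_below_diagonal_cliqueFree_exact k a ha hak hdense
      (fun a' ha' => ⟨hm a' ha' 0 (by omega), by have := hm a' ha' 1 (by omega); omega⟩)
    have e : 2 * (k - 2 - 1) = 2 * (k - 3) := by omega
    rw [e]
    exact h
  · -- `r = 3`
    have h := three_below_diagonal_cliqueFree_exact k a ha hak hdense
      (fun a' ha' => ⟨hm a' ha' 0 (by omega), by have := hm a' ha' 1 (by omega); omega,
        by have := hm a' ha' 2 (by omega); omega⟩)
    have e : 3 * (k - 3 - 1) = 3 * (k - 4) := by omega
    rw [e]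
    exact h

end C047

end TriangleCap

end PercRepro
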